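import Summits.BirchSwinnertonDyer.BirchSwinnertonDyer.Theorems.KolyvaginRankRigidityAtTwoSwapAuxClassLocalAtTwo
import Summits.BirchSwinnertonDyer.BirchSwinnertonDyer.Theorems.KolyvaginRankRigidityAtTwoSwapTwoTermReciprocity
import Summits.BirchSwinnertonDyer.BirchSwinnertonDyer.Theorems.Rank1ResidualJetGlobalDualityOnePlace
import Summits.BirchSwinnertonDyer.BirchSwinnertonDyer.Theorems.Rank1ResidualJetWeilTransportSelmer
import HarnessLib

/-!
# Crux V2♭θ `KolyvaginCorankLowerBoundAtTwoTheta` (stmt-BirchSwinnertonDyer-27220), line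
# `kolyvagin_depth_split`, inside of S1, piece **P5** (auxiliary class with size) — GLOBAL PART:
# the image at `v₀` of the Selmer group relaxed at `v₀` is `σ_*`-stable, isotropic and of Lagrangian
# size; hence Kolyvagin's auxiliary class (helper, PROVED; seat `bsd-line-krr2-p2` g7)

For `𝓕 = 𝓕(m)` (cell bsd-jet's `selmerF`: transverse `𝒯` at the places of `m`, Kummer elsewhere) and the
place `v₀` of a Zhang–Kolyvagin prime `a ∤ m` at `2` of index `≥ M + 1`, `𝓖 = 𝓕^{v₀}` (`relaxedAt`), the
subgroup `A = loc_{v₀}(H¹_𝓖(K, E[2^M])) ≤ H¹(K_{v₀}, E[2^M])` is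
* `σ_*`-stable (`conjAct_mem_selmerGroup_of_transport`, `conjActPlace_mem_selmerF/relaxedAt`, `τ`-stability
  of `𝒯` at the places of `m`),
* isotropic for `⟨·, w_v ·⟩_{v₀}` (Poitou–Tate `SumLocalTermEqZero` for `𝓖[v₀ ↦ 0] ≤ 𝓖` and the self-duality
  of `𝓕(m)` off `v₀` — the lead's `dualTransported_selmerF_eq_of_isImaginaryQuadratic`),
* of Lagrangian size `#A = #Kum_{v₀}`, so `#A² = #H¹(K_{v₀}, E[2^M])` (Poitou–Tate COUNT
  `relIndex_selmerGroup_mul_relIndex_dualSelmerGroup_of_eq_off` for `𝓕 ≤ 𝓖`, Howard's `SelmerComplement`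
  included, the dual side read through the Weil transport: `[H¹_{𝓕^*} : H¹_{𝓖^*}] = #loc_{v₀} H¹_𝓕`).
With the local part (`exists_conjActPlace_eigen_pow_smul_ne_zero_of_isotropic`) this gives
**`exists_auxClass_large_at_two`** = the hypothesis `hP5` of the lead's `primeSwapAtTwoLossy_core` with `c₅ = 5`
(for `M ≥ 9`; the composition only uses `M > 16`), from Zhang's NUMERICAL Kolyvagin condition at `a`, the
Poitou–Tate package (`IsPerfect`, `SumLocalTermEqZero`, `SelmerComplement`, `IsConjCompatible τ`), a Weil datum
equivariant under the adapted lift at `v₀`, and the transverse package at the places of `m` (`h𝒯sd`, `h𝒯σ`).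
HONEST FRAMING: helper (`--supports` 27220); S1 / V2♭θ are NOT proved; BSD is not proved by any of this.
References: [cite: Kolyvagin1991MathAnn, §2] [cite: McCallumLMS1991, §5 Prop. 5.2] [cite: Jetchev2008, §5 Thm. 5.1]
[cite: Howard2004HeegnerKolyvagin, Thm. 2.1.11] [cite: MilneADT2006, Ch. I, Thm. 4.10, Cor. 2.3].
-/

set_option autoImplicit false
set_option linter.dupNamespace false

noncomputable section

open scoped Classical
open Function NumberField IsDedekindDomain WeierstrassCurve Field
open Literature.NumberTheory.EllipticCurves Literature.NumberTheory.GaloisRepresentations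
open Literature.NumberTheory.EllipticCurves.Jetchev2008
open Literature.NumberTheory.GaloisCohomology
open Literature.NumberTheory.GaloisRepresentations.DiscreteGaloisModule (localTatePairingZMod tateDual
  SelmerStructure)
open Summit.BirchSwinnertonDyer.Rank1Residual
open Summit.BirchSwinnertonDyer.Rank1Residual.JET.SelmerVocabulary
open Summit.BirchSwinnertonDyer.Rank1Residual.JET.GlobalDuality

namespace Summit.BirchSwinnertonDyer.BirchSwinnertonDyer.Theorems.KolyvaginLowerBoundAtTwo

variable {K : Type} [Field K] [NumberField K] (W : WeierstrassCurve ℚ) [W.IsElliptic]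
  [W.IsGloballyMinimal] [(W.baseChange K).IsElliptic]
  (τ : K ≃ₐ[ℚ] K) (M : ℕ) [NeZero (2 ^ M)] [Finite (geomTorsion (W.baseChange K) ((2 ^ M : ℕ) : ℤ))]
  (e : geomTorsion (W.baseChange K) ((2 ^ M : ℕ) : ℤ) → geomTorsion (W.baseChange K) ((2 ^ M : ℕ) : ℤ) →
    AlgebraicClosure K)
  (hμ : ∀ S T, e S T ^ (2 ^ M) = 1)
  (hadd₁ : ∀ S₁ S₂ T, e (S₁ + S₂) T = e S₁ T * e S₂ T)
  (hadd₂ : ∀ S T₁ T₂, e S (T₁ + T₂) = e S T₁ * e S T₂)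
  (hgal : ∀ (g : absoluteGaloisGroup K) (S T : geomTorsion (W.baseChange K) ((2 ^ M : ℕ) : ℤ)),
    g • e S T = e (g • S) (g • T))
  (halt : ∀ T, e T T = 1) (hnondeg : ∀ T, (∀ S, e S T = 1) → T = 0)
  (inv : LocalInvariants K (2 ^ M))
  (𝒯 : SelmerStructure ((W.baseChange K).torsionGaloisModule ((2 ^ M : ℕ) : ℤ)))

set_option maxHeartbeats 400000 in
include halt hnondeg in
/-- **P5: Kolyvagin's auxiliary class with size, at `p = 2`** (the hypothesis `hP5` of the lead's S1
composition, with `c₅ = 5`, `M ≥ 9`).  Inputs: `K` imaginary quadratic with non-trivial `τ` (`τ² = 1`);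
the Poitou–Tate family `inv` (`IsPerfect`, `SumLocalTermEqZero`, `SelmerComplement`, `IsConjCompatible τ`);
a Weil datum `e` at level `2^M` (alternating, non-degenerate, `Γ_K`-equivariant) equivariant under the
adapted lift `liftAutPlace τ hfix` at `v₀`; the transverse structure `𝒯`, self-dual and `τ`-stable at the
places of `m ≠ 0`; a Zhang–Kolyvagin prime `a ∤ m` of index `≥ M + 1` with place `v₀`.  Output: `w` in the
`s`-part of `H¹_{𝓕(m)^{v₀}}(K, E[2^M])` with `2^{M/2−5} w ≠ 0`.
[cite: Kolyvagin1991MathAnn, §2 (proof of Thm. 2.2)] [cite: McCallumLMS1991, §5 Prop. 5.2]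
[cite: Jetchev2008, §5 Thm. 5.1, Lemma 5.2] -/
theorem exists_auxClass_large_at_two (hK : IsImaginaryQuadratic K) (hτ1 : τ ≠ 1) (hττ : τ * τ = 1)
    (hperf : inv.IsPerfect) (hvan : inv.SumLocalTermEqZero) (hSC : inv.SelmerComplement)
    (hinvc : inv.IsConjCompatible τ) (hM : 9 ≤ M) {m a : ℕ} (hm0 : m ≠ 0)
    (h𝒯sd : ∀ v ∈ placesDividing K m,
      inv.dualTransported 𝒯 (weilDualIntertwining (W.baseChange K) (2 ^ M) e hμ hadd₁ hadd₂ hgal) (Sum.inr v) =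
        𝒯 (Sum.inr v))
    (h𝒯σ : ∀ (v w : HeightOneSpectrum (𝓞 K)) (h : τ • v = w), v ∈ placesDividing K m →
      ∀ x : galoisCohomology (((W.baseChange K).torsionGaloisModule ((2 ^ M : ℕ) : ℤ)).toLocal
        (Sum.inr v : Place K)) 1, x ∈ 𝒯 (Sum.inr v) → conjActPlace W τ ((2 ^ M : ℕ) : ℤ) h x ∈ 𝒯 (Sum.inr w))
    (ha : Zhang2014.IsKolyvaginPrime (W.conductorNorm ℤ) W K 2 a)
    (hMa : M + 1 ≤ Zhang2014.kolyvaginIndex W 2 a) (ham : ¬ a ∣ m)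
    (v₀ : HeightOneSpectrum (𝓞 K)) (hv₀ : ((a : ℕ) : 𝓞 K) ∈ v₀.asIdeal) (hfix : τ • v₀ = v₀)
    (hτe : ∀ S T, liftAutPlace τ hfix (e S T) =
      e ((isLiftOfAut_liftAutPlace τ hfix).torsionMap W ((2 ^ M : ℕ) : ℤ) S)
        ((isLiftOfAut_liftAutPlace τ hfix).torsionMap W ((2 ^ M : ℕ) : ℤ) T))
    {s : ℤ} (hs : s = 1 ∨ s = -1) :
    ∃ w : galoisCohomology ((W.baseChange K).torsionGaloisModule ((2 ^ M : ℕ) : ℤ)) 1,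
      w ∈ signPart W K τ ((2 ^ M : ℕ) : ℤ) s
        (((selmerF W ((2 ^ M : ℕ) : ℤ) 𝒯 (placesDividing K m)).relaxedAt {v₀}).selmerGroup) ∧
      ((2 ^ (M / 2 - 5) : ℕ) : ℤ) • w ≠ 0 := by
  classical
  haveI : Fact (Nat.Prime 2) := ⟨Nat.prime_two⟩
  haveI : CharZero (v₀.adicCompletion K) :=
    charZero_of_injective_algebraMap (algebraMap K (v₀.adicCompletion K)).injective
  have hM1 : 1 ≤ M := by omega
  have hNpow : IsPrimePow (2 ^ M) := ⟨2, M, Nat.prime_two.prime, hM1, rfl⟩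
  have e2 : ∀ n : ℕ, ((2 ^ n : ℕ) : ℤ) = (2 : ℤ) ^ n := fun n ↦ by norm_num
  have hMtor : ∀ Q : geomTorsion (W.baseChange K) ((2 ^ M : ℕ) : ℤ), (2 ^ M) • Q = 0 := fun Q ↦ by
    simpa using (W.baseChange K).natAbs_nsmul_geomTorsion Q
  have hap : a.Prime := ha.1
  set 𝓕 : SelmerStructure ((W.baseChange K).torsionGaloisModule ((2 ^ M : ℕ) : ℤ)) :=
    selmerF W ((2 ^ M : ℕ) : ℤ) 𝒯 (placesDividing K m) with h𝓕
  set 𝓖 : SelmerStructure ((W.baseChange K).torsionGaloisModule ((2 ^ M : ℕ) : ℤ)) := 𝓕.relaxedAt {v₀}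
    with h𝓖
  set loc := galoisCohomology.localization ((W.baseChange K).torsionGaloisModule ((2 ^ M : ℕ) : ℤ))
    (Sum.inr v₀ : Place K) 1 with hloc
  set A : AddSubgroup (galoisCohomology (((W.baseChange K).torsionGaloisModule ((2 ^ M : ℕ) : ℤ)).toLocal
    (Sum.inr v₀ : Place K)) 1) := 𝓖.selmerGroup.map loc with hA
  have hv₀m : v₀ ∉ placesDividing K m := by
    intro h
    rw [mem_placesDividing_iff_natCast_mem hm0] at h
    have hcop : Nat.Coprime a m := (Nat.Prime.coprime_iff_not_dvd hap).mpr ham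
    apply v₀.isPrime.ne_top
    rw [Ideal.eq_top_iff_one]
    have h1 : ((a.gcdA m * a + a.gcdB m * m : ℤ) : 𝓞 K) ∈ v₀.asIdeal := by
      push_cast
      exact v₀.asIdeal.add_mem (v₀.asIdeal.mul_mem_left _ hv₀) (v₀.asIdeal.mul_mem_left _ h)
    have h2 : (a.gcdA m * a + a.gcdB m * m : ℤ) = 1 := by
      have := Nat.gcd_eq_gcd_ab a m
      rw [hcop] at this
      push_cast at this
      linarith [this]
    rw [h2] at h1
    exact_mod_cast h1
  have h𝓕v₀ : 𝓕 (Sum.inr v₀) = (W.baseChange K).kummerSelmerStructure ((2 ^ M : ℕ) : ℤ) (Sum.inr v₀) := by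
    rw [h𝓕, selmerF_inr, if_neg hv₀m]
  have h𝓖v₀ : 𝓖 (Sum.inr v₀) = ⊤ := by rw [h𝓖, relaxedAt_inr_self]
  have h𝓖v : ∀ v, v ≠ v₀ → 𝓖 (Sum.inr v) = 𝓕 (Sum.inr v) := fun v hv => by
    rw [h𝓖, relaxedAt_inr_of_ne W _ 𝓕 hv]
  have h𝓖inl : ∀ u : InfinitePlace K, 𝓖 (Sum.inl u) = 𝓕 (Sum.inl u) := fun u => by rw [h𝓖, relaxedAt_inl]
  have hle : 𝓕 ≤ 𝓖 := le_relaxedAt W _ 𝓕 {v₀}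
  -- ### `σ`-stability of `H¹_𝓖` and of `A`
  have h𝓕σ : ∀ (v w : HeightOneSpectrum (𝓞 K)) (h : τ • v = w)
      (x : galoisCohomology (((W.baseChange K).torsionGaloisModule ((2 ^ M : ℕ) : ℤ)).toLocal
        (Sum.inr v : Place K)) 1), x ∈ 𝓕 (Sum.inr v) → conjActPlace W τ ((2 ^ M : ℕ) : ℤ) h x ∈ 𝓕 (Sum.inr w) :=
    fun v w h x hx => conjActPlace_mem_selmerF W τ _ 𝒯 hm0 h𝒯σ v w h x hx
  have h𝓖σ : ∀ (v w : HeightOneSpectrum (𝓞 K)) (h : τ • v = w)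
      (x : galoisCohomology (((W.baseChange K).torsionGaloisModule ((2 ^ M : ℕ) : ℤ)).toLocal
        (Sum.inr v : Place K)) 1), x ∈ 𝓖 (Sum.inr v) → conjActPlace W τ ((2 ^ M : ℕ) : ℤ) h x ∈ 𝓖 (Sum.inr w) :=
    fun v w h x hx => conjActPlace_mem_relaxedAt W τ _ h𝓕σ hfix v w h x hx
  have h𝓖top : ∀ u : InfinitePlace K, 𝓖 (Sum.inl u) = ⊤ := fun u =>
    addSubgroup_galoisCohomology_inl_eq_top_of_isComplex _ (hK.2.isComplex u) _
  have hSelσ : ∀ x ∈ 𝓖.selmerGroup, conjAct W τ ((2 ^ M : ℕ) : ℤ) x ∈ 𝓖.selmerGroup := fun x hx =>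
    conjAct_mem_selmerGroup_of_transport W τ _ 𝓖 h𝓖σ h𝓖top hx
  have hAτ : ∀ y ∈ A, conjActPlace W τ ((2 ^ M : ℕ) : ℤ) hfix y ∈ A := by
    rintro _ ⟨x, hx, rfl⟩
    refine ⟨conjAct W τ ((2 ^ M : ℕ) : ℤ) x, hSelσ x hx, ?_⟩
    rw [hloc, conjActPlace_localization]
  -- ### an exceptional set of places containing those of `m · a`
  obtain ⟨S, T, hPT, hST, -, -, hS, h𝓚⟩ := exists_symmetric_exceptional W (1 : K ≃ₐ[ℚ] K) 2 M
    (mul_one 1) (placesDividing K m ∪ {v₀})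
  have hmS : ∀ v ∈ placesDividing K m, (Sum.inr v : Place K) ∈ S := fun v hv =>
    (hST v).mpr (hPT (Finset.mem_union_left _ hv))
  have hv₀T : v₀ ∈ T := hPT (Finset.mem_union_right _ (Finset.mem_singleton_self v₀))
  have h𝓕unr : 𝓕.IsUnramifiedOutside S := selmerF_isUnramifiedOutside W ((2 ^ M : ℕ) : ℤ) 𝒯 h𝓚 hmS
  have h𝓖unr : 𝓖.IsUnramifiedOutside S := by
    refine ⟨h𝓕unr.1, fun v hv ↦ ?_⟩
    have hv₀ : v ≠ v₀ := fun h ↦ hv (h ▸ (hST v₀).mpr hv₀T)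
    rw [h𝓖v v hv₀]
    exact h𝓕unr.2 v hv
  set 𝓖₀ : SelmerStructure ((W.baseChange K).torsionGaloisModule ((2 ^ M : ℕ) : ℤ)) :=
    Function.update 𝓖 (Sum.inr v₀) ⊥ with h𝓖₀
  have h𝓖₀v₀ : 𝓖₀ (Sum.inr v₀) = ⊥ := by rw [h𝓖₀, Function.update_self]
  have h𝓖₀ne : ∀ v, v ≠ Sum.inr v₀ → 𝓖₀ v = 𝓖 v := fun v hv => by rw [h𝓖₀, Function.update_of_ne hv]
  have hle₀ : 𝓖₀ ≤ 𝓖 := fun v => by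
    by_cases hv : v = Sum.inr v₀
    · subst hv; rw [h𝓖₀v₀]; exact bot_le
    · rw [h𝓖₀ne v hv]
  have h𝓖₀unr : 𝓖₀.IsUnramifiedOutside S :=
    ⟨h𝓖unr.1, fun v hv => by
      rw [h𝓖₀ne _ fun h => hv (by rw [h]; exact (hST v₀).mpr hv₀T)]
      exact h𝓖unr.2 v hv⟩
  have hinf₀ : ∀ u : InfinitePlace K, 𝓖₀ (Sum.inl u) = 𝓖 (Sum.inl u) := fun u => h𝓖₀ne _ Sum.inl_ne_inr
  have hsd : ∀ v, inv.dualTransported 𝓕 (weilDualIntertwining (W.baseChange K) (2 ^ M) e hμ hadd₁ hadd₂ hgal) v =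
      𝓕 v :=
    dualTransported_selmerF_eq_of_isImaginaryQuadratic W 2 M e hμ hadd₁ hadd₂ hgal halt hnondeg hK hM1 inv
      (fun v ↦ (hperf v).1.injective) 𝒯 m h𝒯sd
  -- ### isotropy of `A`
  have hAA : ∀ x ∈ A, ∀ y ∈ A,
      localTatePairingZMod ((W.baseChange K).torsionGaloisModule ((2 ^ M : ℕ) : ℤ)) (2 ^ M)
        (Sum.inr v₀ : Place K) (inv (Sum.inr v₀)) x
        (galoisCohomology.map ((weilDualIntertwining (W.baseChange K) (2 ^ M) e hμ hadd₁ hadd₂ hgal).restrictField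
          (v₀.adicCompletion K)) 1 y) = 0 := by
    rintro _ ⟨x, hx, rfl⟩ _ ⟨y, hy, rfl⟩
    set y' := galoisCohomology.map (weilDualIntertwining (W.baseChange K) (2 ^ M) e hμ hadd₁ hadd₂ hgal) 1 y
      with hy'
    have hy'd : y' ∈ (inv.dualSelmerStructure ((W.baseChange K).torsionGaloisModule ((2 ^ M : ℕ) : ℤ)) 𝓖₀).selmerGroup := by
      rw [SelmerStructure.mem_selmerGroup_iff]
      intro v
      rw [LocalInvariants.dualSelmerStructure_apply]
      by_cases hv : v = Sum.inr v₀
      · subst hv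
        rw [h𝓖₀v₀, LocalInvariants.dualLocalCondition_bot]
        trivial
      · rw [h𝓖₀ne v hv]
        have hyv := (SelmerStructure.mem_selmerGroup_iff _ y).mp hy v
        have hyv' : galoisCohomology.localization _ v 1 y ∈ 𝓕 v := by
          rcases v with u | v
          · rw [← h𝓖inl u]; exact hyv
          · rwa [h𝓖v v (fun h => hv (by rw [h]))] at hyv
        rw [← hsd v, LocalInvariants.mem_dualTransported_iff, LocalInvariants.dualSelmerStructure_apply] at hyv'
        have hnat : galoisCohomology.localization (((W.baseChange K).torsionGaloisModule ((2 ^ M : ℕ) : ℤ)).tateDual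
            (2 ^ M)) v 1 y' = DiscreteGaloisModule.localMap (weilDualIntertwining (W.baseChange K) (2 ^ M) e hμ
              hadd₁ hadd₂ hgal) v (galoisCohomology.localization _ v 1 y) :=
          galoisCohomology.res_map_one (Place.Completion v) _ y
        rw [hnat]
        rcases v with u | v
        · rw [h𝓖inl u]; exact hyv'
        · rw [h𝓖v v (fun h => hv (by rw [h]))]; exact hyv'
    have hsum := sum_localTatePairingZMod_selmer_eq_zero
      (ρ := ((W.baseChange K).torsionGaloisModule ((2 ^ M : ℕ) : ℤ))) hvan hMtor S T hST h𝓖₀unr h𝓖unr hinf₀ hx hy'd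
    rw [Finset.sum_eq_single v₀] at hsum
    · have hnat₀ : galoisCohomology.localization (((W.baseChange K).torsionGaloisModule ((2 ^ M : ℕ) : ℤ)).tateDual (2 ^ M)) (Sum.inr v₀ : Place K) 1 y' =
          galoisCohomology.map ((weilDualIntertwining (W.baseChange K) (2 ^ M) e hμ hadd₁ hadd₂ hgal).restrictField
            (v₀.adicCompletion K)) 1 (loc y) :=
        galoisCohomology.res_map_one _ _ y
      rw [hnat₀] at hsum
      exact hsum
    · intro t _ ht
      have hxt : galoisCohomology.localization ((W.baseChange K).torsionGaloisModule ((2 ^ M : ℕ) : ℤ)) (Sum.inr t) 1 x ∈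
          𝓖₀ (Sum.inr t) := by
        rw [h𝓖₀ne _ (fun h => ht (Sum.inr_injective h))]
        exact ((SelmerStructure.mem_selmerGroup_iff _ x).mp hx) (Sum.inr t)
      have hyt := ((SelmerStructure.mem_selmerGroup_iff _ y').mp hy'd) (Sum.inr t)
      rw [LocalInvariants.dualSelmerStructure_apply, LocalInvariants.mem_dualLocalCondition_iff] at hyt
      exact hyt _ hxt
    · intro h; exact absurd hv₀T h
  -- ### the count `#A · #A = #H¹(K_{v₀}, E[2^M])`
  haveI : Finite (galoisCohomology (((W.baseChange K).torsionGaloisModule ((2 ^ M : ℕ) : ℤ)).toLocal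
      (Sum.inr v₀ : Place K)) 1) := finite_galoisCohomology_one_toLocal _ v₀
  have hH : ∀ x : galoisCohomology (((W.baseChange K).torsionGaloisModule ((2 ^ M : ℕ) : ℤ)).toLocal
      (Sum.inr v₀ : Place K)) 1, (2 ^ M) • x = 0 := fun x ↦
    galoisCohomology.nsmul_eq_zero_of_forall _ hMtor x
  -- Poitou–Tate for `𝓕 ≤ 𝓖`: `[H¹_𝓖 : H¹_𝓕] · [H¹_{𝓕^*} : H¹_{𝓖^*}] = [⊤ : Kum_{v₀}]`
  have hPT := relIndex_selmerGroup_mul_relIndex_dualSelmerGroup_of_eq_off inv hperf hvan hSC hMtor S T hST hS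
    hle h𝓕unr h𝓖unr (fun u => (h𝓖inl u).symm) {v₀} (Finset.singleton_subset_iff.mpr hv₀T)
    (fun v _ hv => (h𝓖v v (fun h => hv (Finset.mem_singleton.mpr h))).symm)
  rw [Finset.prod_singleton, h𝓕v₀, h𝓖v₀, AddSubgroup.relIndex_top_right] at hPT
  -- `[H¹_𝓖 : H¹_𝓕] = [A : A ∩ Kum]`
  have hSel𝓕 : 𝓕.selmerGroup = 𝓖.selmerGroup ⊓
      ((W.baseChange K).kummerSelmerStructure ((2 ^ M : ℕ) : ℤ) (Sum.inr v₀)).comap loc := by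
    ext x
    rw [AddSubgroup.mem_inf, AddSubgroup.mem_comap, SelmerStructure.mem_selmerGroup_iff,
      SelmerStructure.mem_selmerGroup_iff]
    constructor
    · intro h
      refine ⟨fun v => hle v (h v), ?_⟩
      rw [← h𝓕v₀]; exact h (Sum.inr v₀)
    · rintro ⟨h, h0⟩ v
      by_cases hv : v = Sum.inr v₀
      · subst hv; rw [h𝓕v₀]; exact h0
      · rcases v with u | v
        · rw [← h𝓖inl u]; exact h (Sum.inl u)
        · rw [← h𝓖v v (fun h' => hv (by rw [h']))]; exact h (Sum.inr v)
  have hidx1 : 𝓕.selmerGroup.relIndex 𝓖.selmerGroup =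
      ((W.baseChange K).kummerSelmerStructure ((2 ^ M : ℕ) : ℤ) (Sum.inr v₀)).relIndex A := by
    rw [hSel𝓕, AddSubgroup.inf_relIndex_left, AddSubgroup.relIndex_comap, hA]
  -- `[H¹_{𝓕^*} : H¹_{𝓖^*}] = #loc_{v₀}(H¹_𝓕)`
  have hdual𝓖 := selmerGroup_dualSelmerStructure_relaxedAt W ((2 ^ M : ℕ) : ℤ) (N := 2 ^ M) inv hperf hMtor 𝓕 v₀
  have hidx2 : (inv.dualSelmerStructure _ 𝓖).selmerGroup.relIndex (inv.dualSelmerStructure _ 𝓕).selmerGroup =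
      Nat.card (𝓕.selmerGroup.map loc) := by
    rw [h𝓖, hdual𝓖, AddSubgroup.inf_relIndex_left, ← AddMonoidHom.comap_bot, AddSubgroup.relIndex_comap,
      AddSubgroup.relIndex_bot_left]
    -- `#loc'(H¹_{𝓕^*}) = #loc(H¹_𝓕)` through the Weil transport
    have hmap : (inv.dualSelmerStructure _ 𝓕).selmerGroup = 𝓕.selmerGroup.map (galoisCohomology.map
        (weilDualIntertwining (W.baseChange K) (2 ^ M) e hμ hadd₁ hadd₂ hgal) 1) := by
      have hc := comap_map_weilDual_selmerGroup_of_selfDual W (2 ^ M) e hμ hadd₁ hadd₂ hgal inv 𝓕 hsd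
      rw [← hc, AddSubgroup.map_comap_eq_self_of_surjective
        (map_weilDual_bijective W (2 ^ M) e hμ hadd₁ hadd₂ hgal hnondeg).2]
    rw [hmap]
    exact natCard_map_localization_map_weilDual W (2 ^ M) e hμ hadd₁ hadd₂ hgal hnondeg (Sum.inr v₀ : Place K)
      𝓕.selmerGroup
  -- `loc(H¹_𝓕) = A ∩ Kum`
  have hlocF : 𝓕.selmerGroup.map loc = A ⊓ (W.baseChange K).kummerSelmerStructure ((2 ^ M : ℕ) : ℤ) (Sum.inr v₀) := by
    ext y
    rw [AddSubgroup.mem_inf, hA]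
    constructor
    · rintro ⟨x, hx, rfl⟩
      have hx' : x ∈ 𝓕.selmerGroup := hx
      rw [hSel𝓕] at hx'
      obtain ⟨hx1, hx2⟩ := AddSubgroup.mem_inf.mp hx'
      exact ⟨⟨x, hx1, rfl⟩, AddSubgroup.mem_comap.mp hx2⟩
    · rintro ⟨⟨x, hx, rfl⟩, hK⟩
      refine ⟨x, ?_, rfl⟩
      have hx' : x ∈ 𝓖.selmerGroup ⊓ ((W.baseChange K).kummerSelmerStructure ((2 ^ M : ℕ) : ℤ) (Sum.inr v₀)).comap loc :=
        AddSubgroup.mem_inf.mpr ⟨hx, AddSubgroup.mem_comap.mpr hK⟩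
      rw [← hSel𝓕] at hx'
      exact hx'
  -- assemble: `[A : A ∩ Kum] · #(A ∩ Kum) = [⊤ : Kum]`, i.e. `#A · #Kum = #H`
  rw [hidx1, hidx2, hlocF] at hPT
  have hAK : ((W.baseChange K).kummerSelmerStructure ((2 ^ M : ℕ) : ℤ) (Sum.inr v₀)).relIndex A *
      Nat.card (A ⊓ (W.baseChange K).kummerSelmerStructure ((2 ^ M : ℕ) : ℤ) (Sum.inr v₀) : AddSubgroup _) =
      Nat.card A := by
    rw [AddSubgroup.relIndex]
    have eqv : (((W.baseChange K).kummerSelmerStructure ((2 ^ M : ℕ) : ℤ) (Sum.inr v₀)).addSubgroupOf A) ≃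
        (A ⊓ (W.baseChange K).kummerSelmerStructure ((2 ^ M : ℕ) : ℤ) (Sum.inr v₀) : AddSubgroup _) :=
      { toFun := fun x => ⟨(x.1 : _), AddSubgroup.mem_inf.mpr ⟨x.1.2, x.2⟩⟩
        invFun := fun y => ⟨⟨y.1, (AddSubgroup.mem_inf.mp y.2).1⟩, (AddSubgroup.mem_inf.mp y.2).2⟩
        left_inv := fun x => rfl
        right_inv := fun y => rfl }
    have hidx := (((W.baseChange K).kummerSelmerStructure ((2 ^ M : ℕ) : ℤ) (Sum.inr v₀)).addSubgroupOf A).index_mul_card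
    rw [Nat.card_congr eqv] at hidx
    exact hidx
  have hKumidx : ((W.baseChange K).kummerSelmerStructure ((2 ^ M : ℕ) : ℤ) (Sum.inr v₀)).index *
      Nat.card ((W.baseChange K).kummerSelmerStructure ((2 ^ M : ℕ) : ℤ) (Sum.inr v₀)) =
      Nat.card (galoisCohomology (((W.baseChange K).torsionGaloisModule ((2 ^ M : ℕ) : ℤ)).toLocal
        (Sum.inr v₀ : Place K)) 1) := AddSubgroup.index_mul_card _
  -- `#Kum · #Kum = #H` (Kummer self-duality, perfectness)
  have hKK : ∀ x, x ∈ (W.baseChange K).kummerSelmerStructure ((2 ^ M : ℕ) : ℤ) (Sum.inr v₀) ↔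
      ∀ y ∈ (W.baseChange K).kummerSelmerStructure ((2 ^ M : ℕ) : ℤ) (Sum.inr v₀),
        ((localTatePairingZMod ((W.baseChange K).torsionGaloisModule ((2 ^ M : ℕ) : ℤ)) (2 ^ M)
          (Sum.inr v₀ : Place K) (inv (Sum.inr v₀))).compl₂ (galoisCohomology.map ((weilDualIntertwining
          (W.baseChange K) (2 ^ M) e hμ hadd₁ hadd₂ hgal).restrictField (v₀.adicCompletion K)) 1)) y x = 0 := by
    intro x
    have hsdK := GaloisImage.dualTransported_kummerSelmerStructure_inr (W.baseChange K) (2 ^ M) e hμ hadd₁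
      hadd₂ hgal halt hnondeg hNpow v₀ (localEulerPoincareCharacteristic_holds (v₀.adicCompletion K)) inv
      ((hperf v₀).1.injective)
    have h1 : x ∈ (W.baseChange K).kummerSelmerStructure ((2 ^ M : ℕ) : ℤ) (Sum.inr v₀) ↔
        x ∈ inv.dualTransported ((W.baseChange K).kummerSelmerStructure ((2 ^ M : ℕ) : ℤ))
          (weilDualIntertwining (W.baseChange K) (2 ^ M) e hμ hadd₁ hadd₂ hgal) (Sum.inr v₀) := by
      rw [hsdK]
    rw [h1, LocalInvariants.mem_dualTransported_iff, LocalInvariants.dualSelmerStructure_apply,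
      LocalInvariants.mem_dualLocalCondition_iff]
    exact Iff.rfl
  have hbflip : Bijective ((localTatePairingZMod ((W.baseChange K).torsionGaloisModule ((2 ^ M : ℕ) : ℤ)) (2 ^ M)
      (Sum.inr v₀ : Place K) (inv (Sum.inr v₀))).compl₂ (galoisCohomology.map ((weilDualIntertwining
      (W.baseChange K) (2 ^ M) e hμ hadd₁ hadd₂ hgal).restrictField (v₀.adicCompletion K)) 1)).flip := by
    have hg_bij : Bijective (galoisCohomology.map ((weilDualIntertwining (W.baseChange K) (2 ^ M) e hμ hadd₁ hadd₂
        hgal).restrictField (v₀.adicCompletion K)) 1) := by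
      refine ⟨X11b.LocBridge.map_weilDual_restrictField_injective (W.baseChange K) (2 ^ M) e hμ hadd₁ hadd₂ hgal
        hnondeg (v₀.adicCompletion K), fun y => ⟨galoisCohomology.map ((X11b.LocBridge.weilDualInv (W.baseChange K)
          (2 ^ M) e hμ hadd₁ hadd₂ hgal hnondeg).restrictField (v₀.adicCompletion K)) 1 y, ?_⟩⟩
      exact X11b.LocBridge.map_weilDual_map_weilDualInv_restrictField (W.baseChange K) (2 ^ M) e hμ hadd₁ hadd₂
        hgal hnondeg (v₀.adicCompletion K) y
    have hflip : ⇑((localTatePairingZMod ((W.baseChange K).torsionGaloisModule ((2 ^ M : ℕ) : ℤ)) (2 ^ M)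
        (Sum.inr v₀ : Place K) (inv (Sum.inr v₀))).compl₂ (galoisCohomology.map ((weilDualIntertwining
        (W.baseChange K) (2 ^ M) e hμ hadd₁ hadd₂ hgal).restrictField (v₀.adicCompletion K)) 1)).flip =
        ⇑(localTatePairingZMod ((W.baseChange K).torsionGaloisModule ((2 ^ M : ℕ) : ℤ)) (2 ^ M)
          (Sum.inr v₀ : Place K) (inv (Sum.inr v₀))).flip ∘ ⇑(galoisCohomology.map ((weilDualIntertwining
          (W.baseChange K) (2 ^ M) e hμ hadd₁ hadd₂ hgal).restrictField (v₀.adicCompletion K)) 1) := by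
      funext y; ext x; rfl
    rw [hflip]
    exact ((hperf v₀).2 _ hMtor).2.comp hg_bij
  have hKsq := LagrangianSign.card_mul_card_eq_of_selfAnnihilating hH _ hbflip _ hKK
  have hA : Nat.card (galoisCohomology (((W.baseChange K).torsionGaloisModule ((2 ^ M : ℕ) : ℤ)).toLocal
      (Sum.inr v₀ : Place K)) 1) ≤ Nat.card A * Nat.card A := by
    -- `#A · #Kum = #H = #Kum · #Kum`
    have hKpos : 0 < Nat.card ((W.baseChange K).kummerSelmerStructure ((2 ^ M : ℕ) : ℤ) (Sum.inr v₀)) :=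
      Nat.card_pos
    have h1 : Nat.card A * Nat.card ((W.baseChange K).kummerSelmerStructure ((2 ^ M : ℕ) : ℤ) (Sum.inr v₀)) =
        Nat.card (galoisCohomology (((W.baseChange K).torsionGaloisModule ((2 ^ M : ℕ) : ℤ)).toLocal
          (Sum.inr v₀ : Place K)) 1) := by
      rw [← hKumidx, ← hPT, ← hAK]
    have h2 : Nat.card A = Nat.card ((W.baseChange K).kummerSelmerStructure ((2 ^ M : ℕ) : ℤ) (Sum.inr v₀)) := by
      apply Nat.eq_of_mul_eq_mul_right hKpos
      rw [h1, hKsq]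
    rw [← h1, h2]
  -- ### the local part: an `s`-eigenclass `y₀ ∈ A` of order `≥ 2^((M-7)/2)`
  obtain ⟨y₀, hy₀A, hy₀τ, hy₀ne⟩ := exists_conjActPlace_eigen_pow_smul_ne_zero_of_isotropic W τ M e hμ hadd₁ hadd₂
    hgal halt hnondeg inv hK (by omega) ha hMa v₀ hv₀ hτ1 hττ hfix hτe hperf hinvc A hAτ hAA hA hs
  obtain ⟨x, hx, hxy⟩ := hy₀A
  have hs2 : s * s = 1 := by rcases hs with rfl | rfl <;> norm_num
  set φ : galoisCohomology ((W.baseChange K).torsionGaloisModule ((2 ^ M : ℕ) : ℤ)) 1 →+ galoisCohomology ((W.baseChange K).torsionGaloisModule ((2 ^ M : ℕ) : ℤ)) 1 :=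
    AddMonoidHom.id _ + s • conjActH1 W K τ ((2 ^ M : ℕ) : ℤ) with hφ
  have hφapply : ∀ z, φ z = z + s • conjActH1 W K τ ((2 ^ M : ℕ) : ℤ) z := fun z => rfl
  refine ⟨φ x, ?_, ?_⟩
  · rw [mem_signPart_iff]
    refine ⟨?_, ?_⟩
    · rw [hφapply, conjActH1_apply]
      exact 𝓖.selmerGroup.add_mem hx (𝓖.selmerGroup.zsmul_mem (hSelσ x hx) s)
    · rw [hφapply, conjActH1_apply, ← conjActH1_apply, map_add, map_zsmul, conjActH1_apply, conjActH1_apply,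
        conjAct_conjAct_of_mul_self W hττ, smul_add, smul_smul, hs2, one_smul, add_comm]
  · -- `loc w = 2 y₀`
    have hlocw : loc (φ x) = (2 : ℤ) • y₀ := by
      rw [hφapply, map_add, map_zsmul, conjActH1_apply, hloc,
        ← conjActPlace_localization W τ ((2 ^ M : ℕ) : ℤ) hfix x, ← hloc, hxy, hy₀τ, smul_smul, hs2, one_smul,
        two_smul]
    intro h0
    apply hy₀ne
    have h1 : ((2 ^ (M / 2 - 5) : ℕ) : ℤ) • loc (φ x) = 0 := by rw [← map_zsmul, h0, map_zero]
    rw [hlocw, smul_smul] at h1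
    -- `2^(M/2-5) · 2 = 2^(M/2-4)` divides `2^((M-7)/2)`
    have hle : M / 2 - 5 + 1 ≤ (M - 7) / 2 := by omega
    obtain ⟨c, hc⟩ := Nat.exists_eq_add_of_le hle
    have hfac : (2 : ℤ) ^ ((M - 7) / 2) = (2 : ℤ) ^ c * (((2 ^ (M / 2 - 5) : ℕ) : ℤ) * 2) := by
      rw [hc]; push_cast; ring
    rw [hfac, mul_smul, h1, smul_zero]

end Summit.BirchSwinnertonDyer.BirchSwinnertonDyer.Theorems.KolyvaginLowerBoundAtTwo

end
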